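/-
Copyright: the b2b-balaban cell (near-miss cell 7), T⁴-continuum fan-out, lineage t4-ne7b-p2 (node U5c RENEWAL member).
Released under the licence of the surrounding project.
-/
import Summits.QuantumFields.BalabanUV.T4Continuum.Support.RenewalSlotGas
import Summits.QuantumFields.BalabanUV.T4Continuum.Support.CountSeamJunction
import Literature.MathematicalPhysics.QuantumFieldTheory.Balaban1983to89.T4StabilitySocket

/-!
# The renewal route assembled: denominator socket + regeneration reading + per-slot renewal masses ⇒ the weight slot ⇒ the seam (ζ′)

Summits-side support leaf of the T⁴-continuum cell (rung (B)+1 on a FINITE torus only; NOT infinite volume, NOT the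
mass gap, NOT the Clay statement; NOT a proof of the spine estimate NE7b).  Lineage `t4-ne7b-p2` (generation 22),
node U5c, RENEWAL route; node A (assembly) of the ROUND-2 skeleton `t4/skeletons/NE7b-t4-ne7b-p2.md`.  [folklore]
composition BY NAME of landed leaves (`RenewalSlotGas.exists_relWeightBound_of_slotMasses`,
`T4StabilitySocket.regeneration_of_lowEnvelope`, `CountSeamJunction.hybridNE7_of_eventually`); nothing is quoted from
print, nothing printed is asserted, no `[cite:]` tag.  (B) enters ONLY through the displayed `LowEnvelope` binders, which
are literally the output type of the landed socket `T4StabilitySocket.lowEnvelope_of_endStatementBPrinted` ∕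
`T4StabilityFloorUnitary.lowEnvelope_of_cor3With_thm1_specialUnitary`; BetaPertH enters only through whatever the
instantiating seat uses to produce the per-slot bound `hslot` (the typed flow (2.5)∕(2.7)∕(2.9) behind the pairing).

WHAT.  §1 **`exists_relWeightBound_of_renewal`** — the skeleton's node A with every leaf a displayed binder:
DENOMINATOR (S3) two `LowEnvelope`s with a common constant `C`; NUMERATOR READING (S2) per run the fields `bad_subset`,
`up` (R3′: `A ≤ dead·F·nup` on the bad fibres), `dead_nonneg`, `resum` (RS), `F_nonneg`, and the domination of the
resummed live price by the live-family weight of the product majorant `ω`; BUDGET (N1–N5 through N4a∕N4c) the cells, the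
per-slot age-decaying pending masses `hslot`, `Λσ < 1`, the fraction of old steps, the live families ⇒
`∃ K₁ ≥ K₀, RelWeightBound l₀ T A A′ (𝟙·badOfClass π T Bad′) (𝟙·C·renewalBudget C_F V (Λσ) j⋆)`.
§2 **`hybridNE7_of_renewal`** — §1 plugged into the seam (ζ′) with the NE7c socket `ShellWeightBound` and NE7's
`ReindexedBudget` (binders) and four summable rates: `∃ K₁ K₂, HybridNE7 …` for the shifted families
(`CountSeamJunction.hybridNE7_of_eventually`, generic in the budget).

NOT DONE HERE.  The instantiation of `hslot` on Bałaban's expansion (leaves N1 ledger, N2 majorant + bank, N3 catalogue,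
N5 partner resummation — through `RenewalGroveSum.sum_le_of_grove_product`), the readings S2 (R3′∕RS∕H3) and S4, the
socket's dictionary binders, `ShellWeightBound` (NE7c), `ReindexedBudget` (NE7).  NE7b discharge: no date.

HONEST DEPENDENCY (cell): continuum YM on T⁴ ⇐ BetaPertH ∧ nine spine estimates (0/9 proved); BetaPertH ⇐ (D1) ∧ (D4)
∧ CAP+tail.  This file changes none of it.
-/

open Finset
open Literature.MathematicalPhysics.QuantumFieldTheory.Balaban1983to89
open T4WeightBudget T4GlobalDenominator T4LiveClassFibration T4LiveStructureGas T4LiveGasToTerms T4StabilitySocket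
open T4IndicatorShell T4MatchingAssembly T4MatchingClosure T4MatchingClosureSocket
open Summit.QuantumFields.BalabanUV.T4Continuum.RenewalSlotGas
open Summit.QuantumFields.BalabanUV.T4Continuum.CountSeamJunction

namespace Summit.QuantumFields.BalabanUV.T4Continuum.RenewalAssembly

noncomputable section

section Assembly

variable {γ ρ ι κ : Type*} [DecidableEq γ] [DecidableEq ρ] [DecidableEq κ] {l₀ vol : ℝ} {K₀ : ℕ}
  {π : ℕ → ι → κ} {T : ℕ → Finset ι} {A A' : ℕ → ℝ → ι → ℝ} {Bad' : ℕ → ℝ → Finset κ}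
  {dead dead' : ℕ → ℝ → ι → ℝ} {F R F' R' : ℕ → κ → ℝ} {nlow nup mlow mup : ℕ → ℝ → ℝ} {C : ℝ}

/-- **NODE A OF THE RENEWAL SKELETON.**  S3 (two `LowEnvelope`s, common `C` — the landed socket's output type under
the (B) pin) + S2 (per run: `bad_subset`, (R3′) `up`, `dead_nonneg`, (RS) `resum`, `F_nonneg`, and the domination
`F·R ≤ famWeight (rslotPrice (ω K)) (str K c)` of the resummed live price by the product majorant) + the budget side of
the renewal route (`Cell` with `#Cell K a ≤ V·Λ^a`; pending records `Rec`; majorant `ω ≥ 0`; THE PER-SLOT BOUND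
`hslot : Σ_{r ∈ Rec K j z} ω K j z r ≤ C_F·σ^(K − j)`; `Λσ < 1`; `j⋆ ≤ K` with fraction `c`; live families `str`
injective on the bad classes with an old slot) ⇒ `∃ K₁ ≥ K₀`, the kernel's `RelWeightBound`.
By `T4StabilitySocket.regeneration_of_lowEnvelope` ×2 and `RenewalSlotGas.exists_relWeightBound_of_slotMasses`.
[folklore] -/
theorem exists_relWeightBound_of_renewal
    -- S3: the denominator halves of the two runs (output type of the landed socket), common constant
    (hEA : LowEnvelope l₀ T A nlow nup C K₀) (hEA' : LowEnvelope l₀ T A' mlow mup C K₀) (hC : 0 ≤ C)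
    -- S2: the numerator reading, run A
    (bad_subset : ∀ K t, |t| ≤ l₀ → K₀ ≤ K → Bad' K t ⊆ classIndex π T K)
    (upA : ∀ K t, |t| ≤ l₀ → K₀ ≤ K → ∀ c ∈ Bad' K t, ∀ τ ∈ fibre π T K c, A K t τ ≤ dead K t τ * F K c * nup K t)
    (deadA_nonneg : ∀ K t, |t| ≤ l₀ → K₀ ≤ K → ∀ c ∈ Bad' K t, ∀ τ ∈ fibre π T K c, 0 ≤ dead K t τ)
    (resumA : ∀ K t, |t| ≤ l₀ → K₀ ≤ K → ∀ c ∈ Bad' K t, ∑ τ ∈ fibre π T K c, dead K t τ ≤ R K c)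
    (FA_nonneg : ∀ K t, |t| ≤ l₀ → K₀ ≤ K → ∀ c ∈ Bad' K t, 0 ≤ F K c)
    -- S2: the numerator reading, run A′
    (upA' : ∀ K t, |t| ≤ l₀ → K₀ ≤ K → ∀ c ∈ Bad' K t, ∀ τ ∈ fibre π T K c, A' K t τ ≤ dead' K t τ * F' K c * mup K t)
    (deadA'_nonneg : ∀ K t, |t| ≤ l₀ → K₀ ≤ K → ∀ c ∈ Bad' K t, ∀ τ ∈ fibre π T K c, 0 ≤ dead' K t τ)
    (resumA' : ∀ K t, |t| ≤ l₀ → K₀ ≤ K → ∀ c ∈ Bad' K t, ∑ τ ∈ fibre π T K c, dead' K t τ ≤ R' K c)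
    (FA'_nonneg : ∀ K t, |t| ≤ l₀ → K₀ ≤ K → ∀ c ∈ Bad' K t, 0 ≤ F' K c)
    -- the budget side of the renewal route
    (Cell : ℕ → ℕ → Finset γ) {V Λ : ℝ} (hV : 0 ≤ V) (hΛ : 0 < Λ)
    (hcell : ∀ K a, ((Cell K a).card : ℝ) ≤ V * Λ ^ a) (Rec : ℕ → ℕ → γ → Finset ρ)
    (ω : ℕ → ℕ → γ → ρ → ℝ) (hω0 : ∀ K, ∀ j ≤ K, ∀ z ∈ Cell K (K - j), ∀ r ∈ Rec K j z, 0 ≤ ω K j z r)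
    {CF σ : ℝ} (hCF : 0 ≤ CF) (hσ : 0 < σ) (hr : Λ * σ < 1)
    (hslot : ∀ K, ∀ j ≤ K, ∀ z ∈ Cell K (K - j), ∑ r ∈ Rec K j z, ω K j z r ≤ CF * σ ^ (K - j))
    (jstar : ℕ → ℕ) (hj : ∀ K, jstar K ≤ K) {c : ℝ} (hc : 0 < c)
    (hfrac : ∀ K : ℕ, c * K ≤ ((K - jstar K : ℕ) : ℝ))
    (str : ℕ → κ → Finset (RSlot γ ρ))
    (hinj : ∀ K t, |t| ≤ l₀ → K₀ ≤ K → Set.InjOn (str K) (Bad' K t))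
    (hstr : ∀ K t, |t| ≤ l₀ → K₀ ≤ K → ∀ c ∈ Bad' K t,
      str K c ⊆ liveSlotsR Cell Rec K ∧ ∃ o ∈ oldSlotsR Cell Rec jstar K, o ∈ str K c)
    (hF : ∀ K t, |t| ≤ l₀ → K₀ ≤ K → ∀ c ∈ Bad' K t, F K c * R K c ≤ famWeight (rslotPrice (ω K)) (str K c))
    (hF' : ∀ K t, |t| ≤ l₀ → K₀ ≤ K → ∀ c ∈ Bad' K t, F' K c * R' K c ≤ famWeight (rslotPrice (ω K)) (str K c)) :
    ∃ K₁, K₀ ≤ K₁ ∧ RelWeightBound l₀ T A A' (fun K t => if K₁ ≤ K then badOfClass π T Bad' K t else ∅)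
      (Set.indicator {K | K₁ ≤ K} (fun K => C * renewalBudget CF V (Λ * σ) jstar K)) :=
  exists_relWeightBound_of_slotMasses Cell hV hΛ hcell Rec ω hω0 hCF hσ hr hslot jstar hj hc hfrac str hinj hstr
    (regeneration_of_lowEnvelope hEA bad_subset upA deadA_nonneg resumA FA_nonneg)
    (regeneration_of_lowEnvelope hEA' bad_subset upA' deadA'_nonneg resumA' FA'_nonneg) hF hF' hC

/-- **… INTO THE SEAM (ζ′).**  Node A's conclusion + the NE7c socket `ShellWeightBound` + NE7's `ReindexedBudget` on
the hybrid cores (binders, on the SAME families with `Bad := badOfClass π T Bad′`) + four summable rates ⇒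
`∃ K₁ K₂, HybridNE7 …` for the families shifted by `K₁ + K₂` (`CountSeamJunction.hybridNE7_of_eventually`). [folklore] -/
theorem hybridNE7_of_renewal [DecidableEq ι] {shA shB Cc Rr CcRec RrRec : ℕ → ℝ → ι → ℝ} {ν u s₂ c₀ rr ss Wsh : ℕ → ℝ}
    (hEA : LowEnvelope l₀ T A nlow nup C K₀) (hEA' : LowEnvelope l₀ T A' mlow mup C K₀) (hC : 0 ≤ C)
    (bad_subset : ∀ K t, |t| ≤ l₀ → K₀ ≤ K → Bad' K t ⊆ classIndex π T K)
    (upA : ∀ K t, |t| ≤ l₀ → K₀ ≤ K → ∀ c ∈ Bad' K t, ∀ τ ∈ fibre π T K c, A K t τ ≤ dead K t τ * F K c * nup K t)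
    (deadA_nonneg : ∀ K t, |t| ≤ l₀ → K₀ ≤ K → ∀ c ∈ Bad' K t, ∀ τ ∈ fibre π T K c, 0 ≤ dead K t τ)
    (resumA : ∀ K t, |t| ≤ l₀ → K₀ ≤ K → ∀ c ∈ Bad' K t, ∑ τ ∈ fibre π T K c, dead K t τ ≤ R K c)
    (FA_nonneg : ∀ K t, |t| ≤ l₀ → K₀ ≤ K → ∀ c ∈ Bad' K t, 0 ≤ F K c)
    (upA' : ∀ K t, |t| ≤ l₀ → K₀ ≤ K → ∀ c ∈ Bad' K t, ∀ τ ∈ fibre π T K c, A' K t τ ≤ dead' K t τ * F' K c * mup K t)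
    (deadA'_nonneg : ∀ K t, |t| ≤ l₀ → K₀ ≤ K → ∀ c ∈ Bad' K t, ∀ τ ∈ fibre π T K c, 0 ≤ dead' K t τ)
    (resumA' : ∀ K t, |t| ≤ l₀ → K₀ ≤ K → ∀ c ∈ Bad' K t, ∑ τ ∈ fibre π T K c, dead' K t τ ≤ R' K c)
    (FA'_nonneg : ∀ K t, |t| ≤ l₀ → K₀ ≤ K → ∀ c ∈ Bad' K t, 0 ≤ F' K c)
    (Cell : ℕ → ℕ → Finset γ) {V Λ : ℝ} (hV : 0 ≤ V) (hΛ : 0 < Λ)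
    (hcell : ∀ K a, ((Cell K a).card : ℝ) ≤ V * Λ ^ a) (Rec : ℕ → ℕ → γ → Finset ρ)
    (ω : ℕ → ℕ → γ → ρ → ℝ) (hω0 : ∀ K, ∀ j ≤ K, ∀ z ∈ Cell K (K - j), ∀ r ∈ Rec K j z, 0 ≤ ω K j z r)
    {CF σ : ℝ} (hCF : 0 ≤ CF) (hσ : 0 < σ) (hr : Λ * σ < 1)
    (hslot : ∀ K, ∀ j ≤ K, ∀ z ∈ Cell K (K - j), ∑ r ∈ Rec K j z, ω K j z r ≤ CF * σ ^ (K - j))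
    (jstar : ℕ → ℕ) (hj : ∀ K, jstar K ≤ K) {c : ℝ} (hc : 0 < c)
    (hfrac : ∀ K : ℕ, c * K ≤ ((K - jstar K : ℕ) : ℝ))
    (str : ℕ → κ → Finset (RSlot γ ρ))
    (hinj : ∀ K t, |t| ≤ l₀ → K₀ ≤ K → Set.InjOn (str K) (Bad' K t))
    (hstr : ∀ K t, |t| ≤ l₀ → K₀ ≤ K → ∀ c ∈ Bad' K t,
      str K c ⊆ liveSlotsR Cell Rec K ∧ ∃ o ∈ oldSlotsR Cell Rec jstar K, o ∈ str K c)
    (hF : ∀ K t, |t| ≤ l₀ → K₀ ≤ K → ∀ c ∈ Bad' K t, F K c * R K c ≤ famWeight (rslotPrice (ω K)) (str K c))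
    (hF' : ∀ K t, |t| ≤ l₀ → K₀ ≤ K → ∀ c ∈ Bad' K t, F' K c * R' K c ≤ famWeight (rslotPrice (ω K)) (str K c))
    -- the seam's other inputs: NE7c socket, NE7 core budget, four summable rates
    (hSh : ShellWeightBound l₀ T A A' shA shB Wsh)
    (hTB : ReindexedBudget l₀ vol T (fun K t τ => A K t τ - shA K t τ) (fun K t τ => A' K t τ - shB K t τ)
      (badOfClass π T Bad') Cc Rr CcRec RrRec ν u s₂ c₀ rr ss)
    (hrr : Summable rr) (hu : Summable u) (hss : Summable ss) (hs₂ : Summable s₂) :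
    ∃ K₁ K₂, K₀ ≤ K₁ ∧ HybridNE7 l₀ vol (fun K => T (K₁ + (K₂ + K))) (fun K => A (K₁ + (K₂ + K)))
      (fun K => A' (K₁ + (K₂ + K))) (fun K => badOfClass π T Bad' (K₁ + (K₂ + K)))
      (fun K => (fun K => C * renewalBudget CF V (Λ * σ) jstar K) (K₁ + (K₂ + K)))
      (fun K => shA (K₁ + (K₂ + K))) (fun K => shB (K₁ + (K₂ + K))) (fun K => Wsh (K₁ + (K₂ + K)))
      (fun K => (rr (K₁ + (K₂ + K)) + u (K₁ + (K₂ + K))) + (ss (K₁ + (K₂ + K)) + s₂ (K₁ + (K₂ + K)))) :=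
  hybridNE7_of_eventually
    (exists_relWeightBound_of_renewal hEA hEA' hC bad_subset upA deadA_nonneg resumA FA_nonneg upA' deadA'_nonneg
      resumA' FA'_nonneg Cell hV hΛ hcell Rec ω hω0 hCF hσ hr hslot jstar hj hc hfrac str hinj hstr hF hF')
    hSh hTB hrr hu hss hs₂

end Assembly

end

end Summit.QuantumFields.BalabanUV.T4Continuum.RenewalAssembly
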